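import Summits.BirchSwinnertonDyer.BirchSwinnertonDyer.Theorems.ByReductionTypeAtTwoTowerFiltrationExponentGap
import HarnessLib

/-!
# The MODULE-FILTRATION certificate, part 6: the EXPONENT lever with TAME places — block exponent
# `= (#places) × (exponent of the decomposition-group action)`, not `(#places) × bits` (route ByReductionTypeAtTwo,
# crux `MultUpperHalfAtTwo`, item stmt-BirchSwinnertonDyer-19922; seat bsd-2adic-mult-2 GEN 11, part 3 of the kernel)

HONEST FRAMING (cell `bsd-2adic`, run/shared/lean/pub/bsd-2adic/, HUMAN RULINGS D-0036/D-0054/D-0074): THEOREMS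
ONLY; nothing asserted; no definition; no new named fact; closes nothing by itself; BSD is not proved by any
of this. PARTITION: X5@2 mult (K4ᵐ, B1·O1) × p = 2 — types-the-object-of (a sharper per-class certificate
format for item 19922 AT the class); closes none. bears_on: K4 (route-BirchSwinnertonDyer-ByReductionTypeAtTwo item 19922).

Part 4 charged a bad place `v` with the block exponent `D_v = log₂ C_v^{#R_v}` (dimension of the local error: a unipotent operator
on a `D`-dimensional `𝔽₂`-space has exponent `≤ D`). This part adds the STRUCTURAL alternative: if the decomposition group at `v`
acts TRIVIALLY (by conjugation) on the `p`-torsion of the local tower kernel `𝒦_{v,n}[p^∞]`, and `γ^{g} ∈ D_v · Gal(K̄/K_n)` with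
`g = p^a` (i.e. `g` is a multiple of the number of places of `K_n` above `v`), then `(conj_γ − id)^{g}` already maps `A_n[p]` into
the partial Selmer condition `P_v` — the block exponent is `g`, however many bits each place carries:
* `iterate_conjSubId_prime_pow_apply` — `(conj_γ − id)^[p^a] y = conj_{γ^{p^a}} y − y` on `p`-torsion classes (`(X+1)^{p^a} ≡ X^{p^a} + 1 (mod p)`,
  tree `IwasawaDual.exists_X_add_one_pow_prime_pow`);
* `commutator_mem_layerSubgroup` — `Γ_K / Gal(K̄/K_n)` is abelian;
* **`iterate_conjSubId_mem_selmerLayer_of_localKernelBounds_tame`** — part 4's theorem with, per place `v ∈ S`, the disjunction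
  «`C_v^{#R_v} ≤ 2^t`» ∨ «`g_v ≤ t`, `g_v = p^a`, `γ^{g_v} ∈ res(Γ_{K_v}) · Gal(K̄/K_n)`, and `conj_δ x = x` for every `δ ∈ Γ_{K_v}` and
  every `x ∈ 𝒦_{v,n}[p^∞]` with `p x = 0`»;
* **`towerGapAtTwo_of_exponent_localKernelBounds_tame`** — the `p = 2` gap from it (as part 5, `(m,k) = (b+t,1)`).
USE (census mult-2 GEN 11): at the totally ramified place over `2` (`R_v = {1}`, `γ ∈ D_v Γ_{ℚ_n}` by tower-1's `cover_singleton_at_p`) a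
NON-SPLIT curve with Tate unit `≡ ±1 (mod 8)` carries two bits; IF the conjugation action on that `(ℤ/2)²` is trivial the block costs `1`,
not `2` (16–24 classes at exponent margin −1); at an additive odd prime with `E[2] ⊂ E(ℚ_ℓ)` likewise (3 classes). The local triviality
statements are NOT proved here — they are the hypotheses `htriv`; this file is the global half.

References: R. Greenberg, LNM 1716 (1999), §3 pp. 85–90 (Lemma 3.5); L. Washington, *Introduction to Cyclotomic Fields*, §13.1–13.2;
J.-P. Serre, *Galois Cohomology*, I.§2.5.
-/
set_option autoImplicit false
-- the Theorems namespace of this sub repeats the summit name by design (D-0017 nested layout: Summit.<S>.<Sub>)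
set_option linter.dupNamespace false

noncomputable section

open scoped Classical

open NumberField IsDedekindDomain WeierstrassCurve Literature.NumberTheory.EllipticCurves
  Literature.NumberTheory.EllipticCurves.IwasawaDual PowerSeries Summit.BirchSwinnertonDyer.Rank1Residual
  Summit.BirchSwinnertonDyer.Rank1Residual.X5.TowerGap Summit.BirchSwinnertonDyer.Rank1Residual.X5.O1

universe u

namespace Summit.BirchSwinnertonDyer.BirchSwinnertonDyer.Theorems.TowerFiltration

/-! ## §8 Two small facts: the Frobenius identity for iterates, commutators die in the layer subgroup -/

section Facts

variable {K : Type u} [Field K] (W : WeierstrassCurve K) {p : ℕ} [hp : Fact p.Prime] (κ : ZpExtension K p)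

/-- **`(conj_γ − id)^[p^a] y = conj_{γ^{p^a}} y − y` on `p`-torsion classes** of `H¹(H, E[p^∞])` (`H` normal in `Γ_K`):
`(X + 1)^{p^a} − X^{p^a} − 1 ∈ p ℤ[X]` (tree `IwasawaDual.exists_X_add_one_pow_prime_pow`) evaluated at `X = conj_γ − 1`.
[cite: Washington1997, §13.2 (Lemma 13.15 ff.)] -/
theorem iterate_conjSubId_prime_pow_apply (H : Subgroup (Field.absoluteGaloisGroup K)) [H.Normal]
    (γ : Field.absoluteGaloisGroup K) (a : ℕ) (y : W.subgroupH1 p H) (hy : p • y = 0) :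
    (⇑(W.conjH1 p H γ - AddMonoidHom.id (W.subgroupH1 p H)))^[p ^ a] y = W.conjH1 p H (γ ^ p ^ a) y - y := by
  let φ : AddMonoid.End (W.subgroupH1 p H) := W.conjH1 p H γ
  have hφ : φ = W.conjH1 p H γ := rfl
  rw [← conjH1_sub_one_pow_apply W H γ φ hφ, ← conjH1_pow_eq W H γ φ hφ]
  obtain ⟨R, hR⟩ := IwasawaDual.exists_X_add_one_pow_prime_pow hp.out a
  have h := congrArg (fun P : Polynomial ℤ ↦ Polynomial.aeval (φ - 1) P y) hR
  simp only [map_sub, map_mul, map_pow, map_add, Polynomial.aeval_X, map_one, sub_add_cancel,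
    eq_intCast, map_intCast] at h
  rw [IwasawaDual.End_sub_apply, IwasawaDual.End_sub_apply, AddMonoid.End.one_apply,
    IwasawaDual.End_intCast_mul_apply, natCast_zsmul, ← map_nsmul, hy, map_zero] at h
  -- h : (φ ^ p ^ a) y - ((φ - 1) ^ p ^ a) y - y = 0
  have : ((φ - 1) ^ p ^ a) y = (φ ^ p ^ a) y - y := by
    rw [sub_sub, sub_eq_zero] at h
    rw [h]; abel
  exact this

/-- **Commutators lie in `Gal(K̄/K_n)`**: `κ` takes values in the abelian group `ℤ_p`, so `κ(aba⁻¹b⁻¹) = 1` and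
`p^n ∣ 0`. [cite: Washington1997, §13.1] -/
theorem commutator_mem_layerSubgroup (a b : Field.absoluteGaloisGroup K) (n : ℕ) :
    a * b * a⁻¹ * b⁻¹ ∈ κ.layerSubgroup n := by
  have h1 : κ (a * b * a⁻¹ * b⁻¹) = 1 := by
    simp only [map_mul, map_inv]
    rw [mul_comm (κ a) (κ b), mul_inv_cancel_right, mul_inv_cancel]
  rw [ZpExtension.mem_layerSubgroup, h1]
  exact ⟨0, by simp⟩

end Facts

/-! ## §9 The TAME variant of the exponent lever -/

section Layer

variable {K : Type u} [Field K] [NumberField K] (W : WeierstrassCurve K) [W.IsElliptic] {p : ℕ}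
  [hp : Fact p.Prime] (κ : ZpExtension K p) {γ : Field.absoluteGaloisGroup K}

omit [W.IsElliptic] in
/-- **`ν^{t}(A_n[p]) ⊆ Sel_{p^∞}(E/K_n)[p]` — TAME variant.** As part 4's `iterate_conjSubId_mem_selmerLayer_of_localKernelBounds`, but each
place `v ∈ S` may be charged EITHER by the count `C_v^{#R_v} ≤ 2^t` OR structurally: `g ≤ t` with `g = p^a`, `γ^g ∈ res(Γ_{K_v})·Gal(K̄/K_n)`
(`g` a multiple of the number of places of `K_n` above `v`) and the decomposition group acting TRIVIALLY by conjugation on the `p`-torsion of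
`𝒦_{v,n}[p^∞]` — then `(conj_γ − id)^{g} = conj_{γ^g} − 1` (on `p`-torsion) already lands in the partial Selmer condition `P_v`
(`ργ^g = δ·ρ·τ'` with a commutator `τ'`, `conjH1_mul`, `conjH1_of_mem`, `localResOver_conjH1_resGal`).
[cite: GreenbergLNM1716, §3 Lemma 3.5 (proof, p. 90)] -/
theorem iterate_conjSubId_mem_selmerLayer_of_localKernelBounds_tame {n t : ℕ}
    (S : Finset (HeightOneSpectrum (𝓞 K))) (C : HeightOneSpectrum (𝓞 K) → ℕ)
    (R : HeightOneSpectrum (𝓞 K) → Finset (Field.absoluteGaloisGroup K))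
    (h0 : ∀ v ∉ S, W.localTowerKerPrimary κ (v.adicCompletion K) n = ⊥)
    (hC : ∀ v ∈ S, Finite {x : W.localTowerKerPrimary κ (v.adicCompletion K) n // p • x = 0} ∧
      Nat.card {x : W.localTowerKerPrimary κ (v.adicCompletion K) n // p • x = 0} ≤ C v)
    (hR : ∀ v ∈ S, ∀ σ : Field.absoluteGaloisGroup K, ∃ ρ ∈ R v,
      ∃ δ : Field.absoluteGaloisGroup (v.adicCompletion K), ∃ τ ∈ κ.layerSubgroup n,
        σ = resGal (K := K) (v.adicCompletion K) δ * ρ * τ)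
    (hexp : ∀ v ∈ S, C v ^ (R v).card ≤ 2 ^ t ∨
      ∃ g : ℕ, g ≤ t ∧ (∃ a : ℕ, g = p ^ a) ∧
        (∃ δ : Field.absoluteGaloisGroup (v.adicCompletion K), ∃ τ ∈ κ.layerSubgroup n,
          γ ^ g = resGal (K := K) (v.adicCompletion K) δ * τ) ∧
        ∀ (δ : Field.absoluteGaloisGroup (v.adicCompletion K))
          (x : discreteH1 (localSubgroup (κ.layerSubgroup n) (v.adicCompletion K)) (localPoints W (v.adicCompletion K))),
          x ∈ W.localTowerKerPrimary κ (v.adicCompletion K) n → p • x = 0 →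
            Literature.NumberTheory.EllipticCurves.conjH1 (localSubgroup (κ.layerSubgroup n) (v.adicCompletion K))
              (localPoints W (v.adicCompletion K)) δ x = x)
    (hfin : Finite {z : W.selmerInftyPreimage κ n // p • z = 0})
    {y : W.subgroupH1 p (κ.layerSubgroup n)} (hy : y ∈ W.selmerInftyPreimage κ n) (hpy : p • y = 0) :
    (⇑(W.conjH1 p (κ.layerSubgroup n) γ - AddMonoidHom.id (W.subgroupH1 p (κ.layerSubgroup n))))^[t] y ∈
        W.selmerLayer κ n ∧
      p • (⇑(W.conjH1 p (κ.layerSubgroup n) γ - AddMonoidHom.id (W.subgroupH1 p (κ.layerSubgroup n))))^[t] y = 0 := by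
  set ν : W.subgroupH1 p (κ.layerSubgroup n) →+ W.subgroupH1 p (κ.layerSubgroup n) :=
    W.conjH1 p (κ.layerSubgroup n) γ - AddMonoidHom.id (W.subgroupH1 p (κ.layerSubgroup n)) with hν
  have hνp : ∀ (k : ℕ) (x : W.subgroupH1 p (κ.layerSubgroup n)), p • (⇑ν)^[k] x = (⇑ν)^[k] (p • x) := fun k ↦ by
    induction k with
    | zero => intro x; rfl
    | succ k ih => intro x; rw [Function.iterate_succ_apply', Function.iterate_succ_apply', ← map_nsmul, ih]
  -- the group `G = A_n[p]`
  let G : AddSubgroup (W.subgroupH1 p (κ.layerSubgroup n)) :=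
    { carrier := {x | x ∈ W.selmerInftyPreimage κ n ∧ p • x = 0}
      zero_mem' := ⟨zero_mem _, smul_zero _⟩
      add_mem' := fun {a b} ha hb ↦ ⟨add_mem ha.1 hb.1, by rw [smul_add, ha.2, hb.2, add_zero]⟩
      neg_mem' := fun {a} ha ↦ ⟨neg_mem ha.1, by rw [smul_neg, ha.2, neg_zero]⟩ }
  have hGmem : ∀ x, x ∈ G ↔ x ∈ W.selmerInftyPreimage κ n ∧ p • x = 0 := fun _ ↦ Iff.rfl
  have hGν : ∀ x ∈ G, ν x ∈ G := fun x hx ↦ by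
    rw [hGmem] at hx ⊢
    refine ⟨?_, ?_⟩
    · rw [hν, AddMonoidHom.sub_apply, AddMonoidHom.id_apply]
      exact sub_mem (conjH1_mem_selmerInftyPreimage W κ γ hx.1) hx.1
    · have := hνp 1 x
      rw [Function.iterate_one] at this
      rw [this, hx.2, map_zero]
  have hGfin : Finite G :=
    Finite.of_injective (fun x : G ↦ (⟨⟨x.1, x.2.1⟩, by
        apply Subtype.ext
        change p • (x.1 : W.subgroupH1 p (κ.layerSubgroup n)) = 0
        exact x.2.2⟩ : {z : W.selmerInftyPreimage κ n // p • z = 0}))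
      fun x x' h ↦ by
        apply Subtype.ext
        have := congrArg (fun z : {z : W.selmerInftyPreimage κ n // p • z = 0} ↦
          ((z.1 : W.selmerInftyPreimage κ n) : W.subgroupH1 p (κ.layerSubgroup n))) h
        exact this
  have hnil : ∀ x ∈ G, (⇑ν)^[p ^ n] x = 0 := fun x hx ↦
    iterate_conjSubId_apply_eq_zero_of_smul_eq_zero W κ γ n x hx.2
  have hyG : y ∈ G := ⟨hy, hpy⟩
  have hiter : ∀ k, ∀ x ∈ G, (⇑ν)^[k] x ∈ G := fun k ↦ by
    induction k with
    | zero => intro x hx; exact hx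
    | succ k ih => intro x hx; rw [Function.iterate_succ_apply']; exact hGν _ (ih x hx)
  have hty : (⇑ν)^[t] y ∈ G := hiter t y hyG
  refine ⟨?_, hty.2⟩
  -- for each `v ∈ S`: the partial Selmer condition `P_v`
  have hloc : ∀ v ∈ S, ∀ ρ ∈ R v,
      W.localResOver p (κ.layerSubgroup n) (v.adicCompletion K)
        (W.conjH1 p (κ.layerSubgroup n) ρ ((⇑ν)^[t] y)) = 0 := by
    intro v hv
    let E := v.adicCompletion K
    let Pv : AddSubgroup (W.subgroupH1 p (κ.layerSubgroup n)) :=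
      { carrier := {x | x ∈ G ∧ ∀ ρ ∈ R v,
          W.localResOver p (κ.layerSubgroup n) E (W.conjH1 p (κ.layerSubgroup n) ρ x) = 0}
        zero_mem' := ⟨zero_mem _, fun ρ _ ↦ by rw [map_zero, map_zero]⟩
        add_mem' := fun {a b} ha hb ↦ ⟨add_mem ha.1 hb.1, fun ρ hρ ↦ by
          rw [map_add, map_add, ha.2 ρ hρ, hb.2 ρ hρ, add_zero]⟩
        neg_mem' := fun {a} ha ↦ ⟨neg_mem ha.1, fun ρ hρ ↦ by rw [map_neg, map_neg, ha.2 ρ hρ, neg_zero]⟩ }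
    have hPvmem : ∀ x, x ∈ Pv ↔ x ∈ G ∧ ∀ ρ ∈ R v,
        W.localResOver p (κ.layerSubgroup n) E (W.conjH1 p (κ.layerSubgroup n) ρ x) = 0 := fun _ ↦ Iff.rfl
    have hPvG : Pv ≤ G := fun x hx ↦ hx.1
    -- `P_v` is `conj_γ`-stable, hence `ν`-stable
    have hPvconj : ∀ x ∈ Pv, W.conjH1 p (κ.layerSubgroup n) γ x ∈ Pv := by
      intro x hx
      rw [hPvmem] at hx ⊢
      refine ⟨⟨conjH1_mem_selmerInftyPreimage W κ γ hx.1.1, by rw [← map_nsmul, hx.1.2, map_zero]⟩,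
        fun ρ hρ ↦ ?_⟩
      obtain ⟨ρ', hρ', δ, τ, hτ, hdec⟩ := hR v hv (ρ * γ)
      have hcomp : W.conjH1 p (κ.layerSubgroup n) ρ (W.conjH1 p (κ.layerSubgroup n) γ x) =
          W.conjH1 p (κ.layerSubgroup n) (ρ * γ) x := by
        rw [W.conjH1_mul_holds p (κ.layerSubgroup n) ρ γ]; rfl
      rw [hcomp, hdec,
        W.conjH1_mul_holds p (κ.layerSubgroup n) (resGal (K := K) E δ * ρ') τ,
        AddMonoidHom.comp_apply, W.conjH1_of_mem_holds p (κ.layerSubgroup n) hτ, AddMonoidHom.id_apply,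
        W.conjH1_mul_holds p (κ.layerSubgroup n) (resGal (K := K) E δ) ρ', AddMonoidHom.comp_apply,
        localResOver_conjH1_resGal, hx.2 ρ' hρ', map_zero]
    have hPvν : ∀ x ∈ Pv, ν x ∈ Pv := fun x hx ↦ by
      rw [hν, AddMonoidHom.sub_apply, AddMonoidHom.id_apply]
      exact sub_mem (hPvconj x hx) hx
    -- the index bound `#G ≤ 2^t · #P_v` (evaluation map at the places above `v`)
    have hcardOf (hcount : C v ^ (R v).card ≤ 2 ^ t) : Nat.card G ≤ 2 ^ t * Nat.card Pv := by
      haveI := hGfin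
      haveI : Finite Pv := Finite.of_injective (fun x : Pv ↦ (⟨x.1, hPvG x.2⟩ : G))
        fun x x' h ↦ Subtype.ext (by simpa using congrArg (fun z : G ↦ (z : W.subgroupH1 p (κ.layerSubgroup n))) h)
      haveI hfinK : Finite {x : W.localTowerKerPrimary κ E n // p • x = 0} := (hC v hv).1
      let Φ : G →+ ((ρ : ↥(R v)) → discreteH1 (localSubgroup (κ.layerSubgroup n) E) (localPoints W E)) :=
        AddMonoidHom.pi fun ρ ↦
          ((W.localResOver p (κ.layerSubgroup n) E).comp (W.conjH1 p (κ.layerSubgroup n) (ρ : Field.absoluteGaloisGroup K))).comp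
            G.subtype
      have hΦ : ∀ (x : G) (ρ : ↥(R v)),
          Φ x ρ = W.localResOver p (κ.layerSubgroup n) E
            (W.conjH1 p (κ.layerSubgroup n) ρ (x : W.subgroupH1 p (κ.layerSubgroup n))) := fun _ _ ↦ rfl
      -- values: `p`-torsion classes of `𝒦_{v,n}[p^∞]`
      have hval : ∀ (x : G) (ρ : ↥(R v)), Φ x ρ ∈ W.localTowerKerPrimary κ E n ∧ p • Φ x ρ = 0 := by
        intro x ρ
        have hpx : p • Φ x ρ = 0 := by
          rw [hΦ, ← map_nsmul, ← map_nsmul]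
          have : p • (x : W.subgroupH1 p (κ.layerSubgroup n)) = 0 := x.2.2
          rw [this, map_zero, map_zero]
        exact ⟨⟨by rw [hΦ]; exact W.localResOver_conjH1_mem_localTowerKer_of_mem κ x.2.1 _ _, 1,
          by rw [pow_one]; exact hpx⟩, hpx⟩
      let g : Φ.range → ((ρ : ↥(R v)) → {x : W.localTowerKerPrimary κ E n // p • x = 0}) := fun z ρ ↦
        ⟨⟨z.1 ρ, by obtain ⟨x, hx⟩ := z.2; rw [← hx]; exact (hval x ρ).1⟩,
          TowerLayer.nsmul_mk_eq_zero _ _ (by obtain ⟨x, hx⟩ := z.2; rw [← hx]; exact (hval x ρ).2)⟩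
      have hg : Function.Injective g := by
        intro z z' h
        refine Subtype.ext (funext fun ρ ↦ ?_)
        have := congrArg (fun w : ((ρ : ↥(R v)) → {x : W.localTowerKerPrimary κ E n // p • x = 0}) ↦
          (((w ρ).1 : W.localTowerKerPrimary κ E n) : discreteH1 (localSubgroup (κ.layerSubgroup n) E) (localPoints W E))) h
        exact this
      haveI : Finite Φ.range := Finite.of_injective g hg
      have hrange : Nat.card Φ.range ≤ 2 ^ t :=
        calc Nat.card Φ.range
            ≤ Nat.card ((ρ : ↥(R v)) → {x : W.localTowerKerPrimary κ E n // p • x = 0}) :=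
              Nat.card_le_card_of_injective g hg
          _ = ∏ ρ : ↥(R v), Nat.card {x : W.localTowerKerPrimary κ E n // p • x = 0} := Nat.card_pi
          _ ≤ ∏ ρ : ↥(R v), C v := Finset.prod_le_prod (fun _ _ ↦ Nat.zero_le _) fun _ _ ↦ (hC v hv).2
          _ = C v ^ (R v).card := by rw [Finset.prod_const, Finset.card_univ, Fintype.card_coe]
          _ ≤ 2 ^ t := hcount
      -- kernel: inside `P_v`
      let kerToPv : Φ.ker → Pv := fun z ↦ ⟨(z.1 : W.subgroupH1 p (κ.layerSubgroup n)), z.1.2, fun ρ hρ ↦ by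
        have := congrFun (show Φ z.1 = 0 from z.2) ⟨ρ, hρ⟩
        rw [hΦ] at this
        exact this⟩
      have hker : Function.Injective kerToPv := by
        intro z z' h
        have := congrArg (fun w : Pv ↦ (w : W.subgroupH1 p (κ.layerSubgroup n))) h
        exact Subtype.ext (Subtype.ext this)
      have hkerle : Nat.card Φ.ker ≤ Nat.card Pv := Nat.card_le_card_of_injective kerToPv hker
      have hGeq : Nat.card G = Nat.card Φ.ker * Nat.card Φ.range := by
        rw [← AddSubgroup.index_ker, AddSubgroup.card_mul_index]
      rw [hGeq, mul_comm]
      exact Nat.mul_le_mul hrange hkerle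
    -- iterates stay in `P_v`
    have hiterPv : ∀ k, ∀ x ∈ Pv, (⇑ν)^[k] x ∈ Pv := fun k ↦ by
      induction k with
      | zero => intro x hx; exact hx
      | succ k ih => intro x hx; rw [Function.iterate_succ_apply']; exact hPvν _ (ih x hx)
    rcases hexp v hv with hcount | ⟨g, hgt, ⟨a, hga⟩, ⟨δ, τ, hτ, hγg⟩, htriv⟩
    · -- the COUNT charge (§5)
      have hmem : (⇑ν)^[t] y ∈ Pv :=
        iterate_mem_of_card_le ν hPvG hGν hPvν hGfin (N := p ^ n)
          (fun x hx ↦ by rw [hnil x hx]; exact zero_mem _) (hcardOf hcount) y hyG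
      exact hmem.2
    · -- the TAME charge: `ν^[g] = conj_{γ^g} − 1` lands in `P_v`
      have hg : ∀ x ∈ G, (⇑ν)^[g] x ∈ Pv := by
        intro x hx
        rw [hga, hν, iterate_conjSubId_prime_pow_apply W (κ.layerSubgroup n) γ a x hx.2, ← hga]
        refine ⟨sub_mem ⟨conjH1_mem_selmerInftyPreimage W κ (γ ^ g) hx.1, by rw [← map_nsmul, hx.2, map_zero]⟩ hx,
          fun ρ hρ ↦ ?_⟩
        -- `ρ γ^g = δ · ρ · τ'` with `τ' ∈ Gal(K̄/K_n)`
        have hτ' : ρ⁻¹ * (τ * ((γ ^ g)⁻¹ * ρ * (γ ^ g)⁻¹⁻¹ * ρ⁻¹)) * ρ⁻¹⁻¹ ∈ κ.layerSubgroup n :=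
          (inferInstance : (κ.layerSubgroup n).Normal).conj_mem _
            (mul_mem hτ (commutator_mem_layerSubgroup κ _ _ n)) ρ⁻¹
        have hdec : ρ * γ ^ g = resGal (K := K) E δ * ρ * (ρ⁻¹ * (τ * ((γ ^ g)⁻¹ * ρ * (γ ^ g)⁻¹⁻¹ * ρ⁻¹)) * ρ⁻¹⁻¹) := by
          rw [inv_inv, inv_inv]
          calc ρ * γ ^ g = γ ^ g * ((γ ^ g)⁻¹ * ρ * γ ^ g * ρ⁻¹) * ρ := by group
            _ = resGal (K := K) E δ * τ * ((γ ^ g)⁻¹ * ρ * γ ^ g * ρ⁻¹) * ρ := by rw [hγg]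
            _ = _ := by group
        have hcomp : W.conjH1 p (κ.layerSubgroup n) ρ (W.conjH1 p (κ.layerSubgroup n) (γ ^ g) x) =
            W.conjH1 p (κ.layerSubgroup n) (ρ * γ ^ g) x := by
          rw [W.conjH1_mul_holds p (κ.layerSubgroup n) ρ (γ ^ g)]; rfl
        have hKx : W.localResOver p (κ.layerSubgroup n) E (W.conjH1 p (κ.layerSubgroup n) ρ x) ∈
            W.localTowerKerPrimary κ E n ∧
            p • W.localResOver p (κ.layerSubgroup n) E (W.conjH1 p (κ.layerSubgroup n) ρ x) = 0 := by
          have hpx : p • W.localResOver p (κ.layerSubgroup n) E (W.conjH1 p (κ.layerSubgroup n) ρ x) = 0 := by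
            rw [← map_nsmul, ← map_nsmul, hx.2, map_zero, map_zero]
          exact ⟨⟨W.localResOver_conjH1_mem_localTowerKer_of_mem κ hx.1 _ _, 1, by rw [pow_one]; exact hpx⟩, hpx⟩
        rw [map_sub, map_sub, hcomp, hdec,
          W.conjH1_mul_holds p (κ.layerSubgroup n) (resGal (K := K) E δ * ρ) _, AddMonoidHom.comp_apply,
          W.conjH1_of_mem_holds p (κ.layerSubgroup n) hτ', AddMonoidHom.id_apply,
          W.conjH1_mul_holds p (κ.layerSubgroup n) (resGal (K := K) E δ) ρ, AddMonoidHom.comp_apply,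
          localResOver_conjH1_resGal, htriv δ _ hKx.1 hKx.2, sub_self]
      have hmem : (⇑ν)^[t] y ∈ Pv := by
        rw [show t = (t - g) + g by omega, Function.iterate_add_apply]
        exact hiterPv _ _ (hg y hyG)
      exact hmem.2
  exact W.mem_selmerLayer_of_forall_localResOver_conjH1_eq_zero κ S h0 R hR hty.1 hloc

end Layer

end Summit.BirchSwinnertonDyer.BirchSwinnertonDyer.Theorems.TowerFiltration

end
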